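import Summits.CriticalPhenomena.PercolationContinuityZ3.Theorems.PercLowPointHalfSpaceTallClusterMassBoundBulkWallArmProduct
import Summits.CriticalPhenomena.PercolationContinuityZ3.Theorems.PercLowPointHalfSpaceTallClusterMassBoundAccessibleDefs
import Literature.Probability.Percolation.RSW

/-!
# `TallClusterMassBound` (stmt-CriticalPhenomena-0912), line `Sketch` — stub `stub_accTwoArm`:
# accessible points are doubly wall-rooted, `P_p(acc x) ≤ π_p(k)²` for `‖x‖∞ ≥ 2k+1`

Registered stub `stub_accTwoArm` of the line `Sketch` of crux B
(`Summit.CriticalPhenomena.PercolationContinuityZ3.Theses.PercLowPointHalfSpace.TallClusterMassBound`), the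
"skeleton bound (A)" of the accessible/overhang decomposition: for EVERY parameter `p`, every `k` and every
`x ∈ ℤ³` with `‖x‖∞ ≥ 2k + 1`,

  `P_p(acc x) ≤ π_p(k)²`,  `acc x = {0 ⟷ x in slab (x 0)}`, `slab h = {0 ≤ y₀ ≤ h}`, `π_p(k) = P_p(arm_ℍ(0,k))`.

Proof (independence in disjoint balls + the reflection trick, exactly as the landed template
`ReplicaOverlap.real_openConnIn_le_siteToBoundary_mul_armH` with the box `Λ_{2a+1}` replaced by the slab):
an open path inside the slab `S = slab (x 0)` from `0` to `x`
* first exits `Λ_k` (as `‖x‖∞ > k`): its initial piece is an open path inside `F₁ = Λ_k ∩ ℍ` from `0` to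
  `∂Λ_k`, an event `E₁ ⊆ arm_ℍ(0,k)`;
* read backwards from `x`, first exits `x + Λ_k` (as `0 ∉ x + Λ_k`): an open path inside
  `F₂ = (x + Λ_k) ∩ S` from `x` to `x + ∂Λ_k`, an event `E₂`.
The events are determined by the disjoint (`‖x‖∞ ≥ 2k+1`, sup-norm triangle inequality) edge sets
`F₁.sym2`, `F₂.sym2`, hence independent (`DCT16.real_inter_of_determinedBy_disjoint`), and the lattice
isomorphism `faceIso x 0 (-1) : y ↦ (x₀ - y₀, y₁ - x₁, y₂ - x₂)` maps `F₂ ⊆ {y₀ ≤ x₀}` into `ℍ`, `x` to `0`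
and `x + ∂Λ_k` to sup-distance `≥ k` (`exists_le_abs_faceIso_of_sub_mem_innerBoundary`), so
`P(E₂) ≤ P(arm_ℍ(0,k))` (`bondPercolation_real_preimage_relabel_iso`). No criticality is used.
-/

noncomputable section

open MeasureTheory Finset
open Literature.Probability.Percolation Literature.Probability.LatticeModels
open Summit.CriticalPhenomena.PercolationContinuityZ3.Theorems.TallClusterMassBound.Negative
open Summit.CriticalPhenomena.PercolationContinuityZ3.Theorems.QuantitativeBGN.Negative
open Summit.CriticalPhenomena.PercolationContinuityZ3.Theorems.TallClusterMassBound.ReplicaOverlap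

namespace Summit.CriticalPhenomena.PercolationContinuityZ3.Theorems.TallClusterMassBound.AccessibleSkeleton

/-! ## Sup-norm bookkeeping -/

/-- The sup-norm is even: `‖-z‖∞ = ‖z‖∞`. [folklore] -/
theorem snorm_neg (z : V3) : snorm (-z) = snorm z := by
  simp [snorm]

/-- The sup-norm triangle inequality `‖a + b‖∞ ≤ ‖a‖∞ + ‖b‖∞`. [folklore] -/
theorem snorm_add_le (a b : V3) : snorm (a + b) ≤ snorm a + snorm b := by
  have h0 := Int.natAbs_add_le (a 0) (b 0)
  have h1 := Int.natAbs_add_le (a 1) (b 1)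
  have h2 := Int.natAbs_add_le (a 2) (b 2)
  simp only [snorm, Pi.add_apply]
  omega

/-- `‖w‖∞ ≤ ‖w - x‖∞ + ‖x‖∞`. [folklore] -/
theorem snorm_le_snorm_sub_add (w x : V3) : snorm w ≤ snorm (w - x) + snorm x := by
  have h := snorm_add_le (w - x) x
  rwa [sub_add_cancel] at h

/-- `‖x‖∞ ≤ ‖u‖∞ + ‖u - x‖∞`. [folklore] -/
theorem snorm_le_snorm_add_snorm_sub (u x : V3) : snorm x ≤ snorm u + snorm (u - x) := by
  have h := snorm_add_le u (-(u - x))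
  rwa [snorm_neg, ← sub_eq_add_neg, sub_sub_cancel] at h

/-- The balls `Λ_k` and `x + Λ_k` are disjoint once `‖x‖∞ ≥ 2k + 1`. [folklore] -/
theorem not_mem_box_of_sub_mem_box {k : ℕ} {x u : V3} (hx : 2 * k + 1 ≤ snorm x)
    (hu : u - x ∈ box 3 k) : u ∉ box 3 k := by
  intro hu'
  rw [mem_box_iff_snorm] at hu hu'
  have h1 := snorm_le_snorm_add_snorm_sub u x
  omega

/-! ## The two-arm bound -/

/-- **Accessible points are doubly wall-rooted** (registered stub `stub_accTwoArm` of line `Sketch`):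
for every `p`, `k`, and `x` with `‖x‖∞ ≥ 2k+1`, `P_p(acc x) ≤ π_p(k)²` — first exit from `Λ_k`, last entrance
into `x + Λ_k` inside the slab (disjoint supports, hence independence), and the reflection `faceIso x 0 (-1)`
turning the ceiling-rooted arm at `x` into a wall-rooted arm at `0`. [folklore] -/
theorem stub_accTwoArm :
    ∀ (p : unitInterval) (k : ℕ) (x : V3), 2 * k + 1 ≤ snorm x → (Pp p).real (acc x) ≤ armProb p k ^ 2 := by
  intro p k x hx
  classical
  -- the regions of the two events: `F₁ = Λ_k ∩ ℍ`, `F₂ = (x + Λ_k) ∩ slab (x 0)` (cut out of a big box)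
  set F₁ : Finset V3 := (box 3 k).filter (fun w => 0 ≤ w 0) with hF₁
  set F₂ : Finset V3 :=
    (box 3 (snorm x + k)).filter (fun w => w - x ∈ box 3 k ∧ 0 ≤ w 0 ∧ w 0 ≤ x 0) with hF₂
  set E₁ : Set (BondConfig V3) :=
    ⋃ a : V3, ⋃ (_ : a ∈ innerBoundary (zdGraph 3) (box 3 k)), openConnIn (↑F₁) 0 a with hE₁
  set E₂ : Set (BondConfig V3) :=
    ⋃ z : V3, ⋃ (_ : z - x ∈ innerBoundary (zdGraph 3) (box 3 k)), openConnIn (↑F₂) x z with hE₂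
  have hxk : x ∉ box 3 k := by rw [mem_box_iff_snorm]; omega
  -- (1) containment, for configurations on lattice edges
  have hsub : ∀ ω : BondConfig V3, ω ⊆ (zdGraph 3).edgeSet → ω ∈ acc x → ω ∈ E₁ ∩ E₂ := by
    intro ω hω hωx
    have hpath : PathIn (openGraph ω) (slab (x 0)) 0 x := DCT16.mem_openConnIn_iff_pathIn.1 hωx
    constructor
    · -- first exit from `Λ_k`
      have h0R : (0 : V3) ∈ (↑(box 3 k) : Set V3) := Finset.mem_coe.2 (zero_mem_box 3 k)
      have hxR : x ∉ (↑(box 3 k) : Set V3) := fun h => hxk (Finset.mem_coe.1 h)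
      obtain ⟨a, b, ha, hb, -, hab, hpre⟩ := hpath.exit h0R hxR
      have habd : a ∈ innerBoundary (zdGraph 3) (box 3 k) := by
        rw [mem_innerBoundary_iff]
        exact ⟨Finset.mem_coe.1 ha, b, fun h => hb (Finset.mem_coe.2 h), DCT16.adj_of_openGraph_adj hω hab⟩
      have hpreF : PathIn (openGraph ω) (↑F₁) 0 a := by
        refine hpre.mono fun w hw => ?_
        rw [Finset.mem_coe, hF₁, Finset.mem_filter]
        exact ⟨Finset.mem_coe.1 hw.1, hw.2.1⟩
      rw [hE₁, Set.mem_iUnion]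
      exact ⟨a, Set.mem_iUnion.2 ⟨habd, DCT16.mem_openConnIn_of_pathIn hpreF⟩⟩
    · -- first exit of the reversed path from `x + Λ_k`
      have hxR : x ∈ {w : V3 | w - x ∈ box 3 k} := by simp
      have h0R : (0 : V3) ∉ {w : V3 | w - x ∈ box 3 k} := by
        rw [Set.mem_setOf_eq, zero_sub, mem_box_iff_snorm, snorm_neg]
        omega
      obtain ⟨u, v, hu, hv, -, huv, hpre⟩ := hpath.symm.exit hxR h0R
      have hubd : u - x ∈ innerBoundary (zdGraph 3) (box 3 k) := by
        rw [mem_innerBoundary_iff]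
        refine ⟨hu, v - x, hv, ?_⟩
        rw [DCT16.zdGraph_adj_sub_iff]
        exact DCT16.adj_of_openGraph_adj hω huv
      have hpreF : PathIn (openGraph ω) (↑F₂) x u := by
        refine hpre.mono fun w hw => ?_
        obtain ⟨hw1, hw2⟩ := hw
        rw [Set.mem_setOf_eq] at hw1
        rw [Finset.mem_coe, hF₂, Finset.mem_filter]
        refine ⟨?_, hw1, hw2.1, hw2.2⟩
        rw [mem_box_iff_snorm] at hw1 ⊢
        have h1 := snorm_le_snorm_sub_add w x
        omega
      rw [hE₂, Set.mem_iUnion]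
      exact ⟨u, Set.mem_iUnion.2 ⟨hubd, DCT16.mem_openConnIn_of_pathIn hpreF⟩⟩
  -- (2) the supports are disjoint
  have hdisj : Disjoint F₁.sym2 F₂.sym2 := by
    refine Finset.disjoint_left.2 fun e => ?_
    refine Sym2.ind (fun u v => ?_) e
    intro h1 h2
    rw [Finset.mk_mem_sym2_iff] at h1 h2
    have hu1 := h1.1
    have hu2 := h2.1
    rw [hF₁, Finset.mem_filter] at hu1
    rw [hF₂, Finset.mem_filter] at hu2
    exact not_mem_box_of_sub_mem_box hx hu2.2.1 hu1.1
  -- (3) locality of the two events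
  have hdet₁ : DeterminedBy E₁ (↑F₁.sym2 : Set (Sym2 V3)) :=
    DeterminedBy.iUnion fun a => DeterminedBy.iUnion fun _ =>
      DCT16.determinedBy_openConnIn (↑F₁) 0 a (K := ↑F₁.sym2) (by rw [Finset.coe_sym2])
  have hdet₂ : DeterminedBy E₂ (↑F₂.sym2 : Set (Sym2 V3)) :=
    DeterminedBy.iUnion fun z => DeterminedBy.iUnion fun _ =>
      DCT16.determinedBy_openConnIn (↑F₂) x z (K := ↑F₂.sym2) (by rw [Finset.coe_sym2])
  -- (4a) the first event is a half-space arm (`F₁ ⊆ ℍ`)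
  have hE₁le : (bondPercolation (zdGraph 3) p).real E₁ ≤ (bondPercolation (zdGraph 3) p).real (armH k) := by
    refine measureReal_mono fun ω hω => ?_
    rw [hE₁, Set.mem_iUnion] at hω
    obtain ⟨a, ha⟩ := hω
    rw [Set.mem_iUnion] at ha
    obtain ⟨ha, hωa⟩ := ha
    refine ⟨a, ?_, openConnIn_mono ?_ 0 a hωa⟩
    · obtain ⟨j, hj⟩ := exists_eq_of_mem_innerBoundary_box ha
      refine ⟨j, ?_⟩
      rcases hj with h | h <;> rw [h] <;> simp
    · intro w hw
      rw [Finset.mem_coe, hF₁, Finset.mem_filter] at hw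
      exact hw.2
  -- (4b) the second event is a half-space arm after the reflection `faceIso x 0 (-1)`
  have hE₂le : (bondPercolation (zdGraph 3) p).real E₂ ≤ (bondPercolation (zdGraph 3) p).real (armH k) := by
    rw [← bondPercolation_real_preimage_relabel_iso (faceIso x 0 (-1)) p (armH k)]
    refine measureReal_mono fun ω hω => ?_
    rw [hE₂, Set.mem_iUnion] at hω
    obtain ⟨z, hz⟩ := hω
    rw [Set.mem_iUnion] at hz
    obtain ⟨hz, hωz⟩ := hz
    rw [Set.mem_preimage]
    have hpath := DCT16.mem_openConnIn_iff_pathIn.1 hωz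
    have hH : ∀ w ∈ ((F₂ : Finset V3) : Set V3), 0 ≤ (faceIso x 0 (-1)).toEquiv w 0 := by
      intro w hw
      rw [Finset.mem_coe, hF₂, Finset.mem_filter] at hw
      rw [faceIso_apply_zero, Units.coe_neg_one]
      linarith [hw.2.2.2]
    have hmap := DCT16.pathIn_map
      (G' := openGraph (BondConfig.relabel (sym2Equiv (faceIso x 0 (-1)).toEquiv) ω))
      (faceIso x 0 (-1)).toEquiv (B := {z : Site 3 | 0 ≤ z 0}) hH
      (fun a b _ _ hab => (openGraph_relabel_adj_iff (faceIso x 0 (-1)).toEquiv ω a b).2 hab) hpath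
    rw [faceIso_apply_self] at hmap
    exact ⟨(faceIso x 0 (-1)).toEquiv z, exists_le_abs_faceIso_of_sub_mem_innerBoundary x 0 (-1) hz,
      DCT16.mem_openConnIn_of_pathIn hmap⟩
  -- (5) assemble
  calc (Pp p).real (acc x) = (bondPercolation (zdGraph 3) p).real (acc x) := rfl
    _ ≤ (bondPercolation (zdGraph 3) p).real (E₁ ∩ E₂) :=
        DCT16.real_mono_of_forall_subset_edgeSet (zdGraph 3) p hsub
    _ = (bondPercolation (zdGraph 3) p).real E₁ * (bondPercolation (zdGraph 3) p).real E₂ :=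
        DCT16.real_inter_of_determinedBy_disjoint (zdGraph 3) p hdet₁ hdet₂ hdisj
    _ ≤ (bondPercolation (zdGraph 3) p).real (armH k) * (bondPercolation (zdGraph 3) p).real (armH k) :=
        mul_le_mul hE₁le hE₂le measureReal_nonneg measureReal_nonneg
    _ = armProb p k ^ 2 := by rw [sq, armProb_eq_real_armH]

end Summit.CriticalPhenomena.PercolationContinuityZ3.Theorems.TallClusterMassBound.AccessibleSkeleton
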